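import Literature.NumberTheory.DiophantineGeometry.FunctionFieldResidues
import HarnessLib

/-!
# The divisor of `dy` and the Riemann–Hurwitz formula in the tame case (all characteristics);
  an everywhere unramified `y` generates the function field

Topic: `Literature/NumberTheory/DiophantineGeometry`. Continuation of
`Literature.NumberTheory.DiophantineGeometry.FunctionFieldResidues` (Tate's residues, the Weil
differential `dy = dOf K y`, its divisor `(dy)_P = diffOrd_P(y)` and the Riemann–Hurwitz formula
`Σ_P diffOrd_P(y) = 2g - 2`), which proves the divisor formula under `[CharZero K]`. The only place
where characteristic `0` enters those proofs is the leading-term computation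
`res_P(t⁻ⁿ dy) = n · u(P)` (Tate's Thm. 2) — it detects the order of `dy` at `P` exactly when the
integer `n = diffOrd_P(y) + 1` (`= e_P`, the ramification index of `P` over `K(y)`, at a finite place;
`= -e_P` at a pole) is non-zero **in `K`**, i.e. when `P | K(y)` is *tamely* ramified. This file records
the characteristic-free statements, with exactly that hypothesis:

* `dOf_ne_zero_of_cast_ne_zero` — `dy ≠ 0` as soon as `(diffOrd_P(y) + 1 : K) ≠ 0` at ONE rational
  place `P`;
* `differentialDivisor_dOf_apply_of_cast_ne_zero` — `(dy)_P = diffOrd_P(y)` at every rational place `P`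
  with `(diffOrd_P(y) + 1 : K) ≠ 0` (Dedekind's different theorem `d(P) = e_P - 1` in the tame case,
  Stichtenoth Thm. 3.5.1 (b), with Remark 4.3.7 / Cor. 3.4.7: `(dy) = -2 (y)_∞ + Diff(F/K(y))`);
* `finsum_diffOrd_eq_of_forall_cast_ne_zero` — the **Riemann–Hurwitz formula for a tame `y`** in any
  characteristic: if all places are rational and `(diffOrd_P(y) + 1 : K) ≠ 0` for every `P`, then
  `Σ_P diffOrd_P(y) = 2g - 2`, i.e. `2g - 2 = -2 [F : K(y)] + Σ_P (e_P - 1)` (Stichtenoth Cor. 3.5.5 /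
  Thm. 3.4.13 for `F/K(y)`, `g(K(y)) = 0`);
* `finrank_eq_one_of_unramified`, `genus_eq_zero_of_unramified`, `adjoin_simple_eq_top_of_unramified`
  — the case used for the simple connectedness of `ℙ¹` (SGA 1, XI 1.1: "`1 - g' = d (1 - g)` … exige
  `d = 1`"): if `y ∉ K` is **unramified at every place** — `v_P(y - y(P)) = 1` where `y` is finite and
  `v_P(y) = -1` at the poles — then `diffOrd_P(y) ∈ {0, -2}`, the hypothesis holds in every
  characteristic (`±1 ≠ 0`), the poles number `[F : K(y)]` (`sum_neg_ord_eq_finrank`, Stichtenoth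
  Thm. 1.4.11), so `2g - 2 = -2 [F : K(y)]`, whence `g = 0` and `[F : K(y)] = 1`: **`F = K(y)`**.

Everything is proved; no named facts are introduced. The proofs of the first two statements are those of
`dOf_ne_zero` / `differentialDivisor_dOf_apply` in `FunctionFieldResidues` with `CharZero` replaced by the
pointwise hypothesis.

## References

* H. Stichtenoth, *Algebraic Function Fields and Codes*, 2nd ed., GTM 254 (2009): Thm. 1.4.11,
  Cor. 3.4.7, Thm. 3.4.13, Thm. 3.5.1, Cor. 3.5.5, Remark 4.3.7. [Stichtenoth2009]
* J. Tate, *Residues of differentials on curves*, Ann. Sci. ÉNS (4) 1 (1968) 149–159, §3 Thm. 2, §4.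
  [Tate1968]
* A. Grothendieck, M. Raynaud, SGA 1, Exp. XI, Prop. 1.1 (proof for `r = 1`). [SGA1]
-/

noncomputable section

open scoped Classical IntermediateField
open Module

namespace Literature.NumberTheory.DiophantineGeometry.AlgFunctionField

universe u v

variable {K : Type u} {F : Type v} [Field K] [Field F] [Algebra K F]

/-! ### The divisor of `dy` at a tame place -/

section divisor

variable [IsAlgFunctionField K F] [IsIntegrallyClosedIn K F]

/-- `dy ≠ 0` for `y ∉ K` as soon as, at some rational place `P`, the integer `n = diffOrd_P(y) + 1`
(`= ± e_P`) is non-zero in `K`: `res_P(t⁻ⁿ dy) = n · u(P) ≠ 0` (Tate's Thm. 2). In characteristic `0`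
this is `dOf_ne_zero`. [cite: Tate1968, §4, Thm. 5] -/
theorem dOf_ne_zero_of_cast_ne_zero {P : PlaceOver K F} (hP : P.IsRational) {y : F}
    (hy : y ∉ Set.range (algebraMap K F)) (hn : ((P.diffOrd y + 1 : ℤ) : K) ≠ 0) :
    dOf K y ≠ 0 := by
  obtain ⟨c, c_u, u, -, hyexp, hu, hcu⟩ := hP.exists_expansion hy
  intro h
  have h1 : (dOf K y : Module.Dual K (Adele K F))
      (Adele.single P ((P.uniformizer : F) ^ (-(P.diffOrd y + 1)))) = 0 := by
    rw [h]; rfl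
  rw [dOf_single, PlaceOver.localRes_zpow_neg_of_expansion hP hyexp hcu] at h1
  exact mul_ne_zero hn (PlaceOver.ne_zero_of_sub_algebraMap_mem hu hcu) h1

/-- **The divisor of `dy` at a tame place** (any characteristic). Let `F/K` be an algebraic function
field with full constant field `K`, `y ∈ F ∖ K` with `dy ≠ 0`, and `P` a rational place at which
`n = diffOrd_P(y) + 1` is non-zero in `K` (tame ramification over `K(y)`). Then
`(dy)_P = diffOrd_P(y)`, i.e. `(dy)_P = v_P(y - y(P)) - 1 = e_P - 1` if `y ∈ 𝒪_P` and
`(dy)_P = v_P(y) - 1 = -e_P - 1` at a pole (Dedekind's different theorem in the tame case; from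
Tate's Thm. 2: `res_P(a dy) = 0` for `v_P(a) ≥ 1 - n`, `res_P(t⁻ⁿ dy) = n u(P) ≠ 0`).
[cite: Stichtenoth2009, Thm. 3.5.1, Cor. 3.4.7] -/
theorem differentialDivisor_dOf_apply_of_cast_ne_zero {y : F} (hy : y ∉ Set.range (algebraMap K F))
    (hω : dOf K y ≠ 0) {P : PlaceOver K F} (hP : P.IsRational)
    (hnK : ((P.diffOrd y + 1 : ℤ) : K) ≠ 0) :
    differentialDivisor (dOf K y) P = P.diffOrd y := by
  set W := differentialDivisor (dOf K y) with hW
  obtain ⟨c, c_u, u, -, hyexp, hu, hcu⟩ := hP.exists_expansion hy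
  set n := P.diffOrd y + 1 with hn_def
  have hres : P.localRes K ((P.uniformizer : F) ^ (-n)) y ≠ 0 := by
    rw [PlaceOver.localRes_zpow_neg_of_expansion hP hyexp hcu]
    exact mul_ne_zero hnK (PlaceOver.ne_zero_of_sub_algebraMap_mem hu hcu)
  have hωW := ((mem_weilDifferentialSpace_iff' W _).1
    (mem_weilDifferentialSpace_differentialDivisor hω)).1
  apply le_antisymm
  · -- `W P ≤ n - 1`: otherwise `single_P t⁻ⁿ ∈ 𝒜(W)` is killed by `dy`
    by_contra hlt
    have hle : n ≤ W P := by omega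
    have hmem : Adele.single P ((P.uniformizer : F) ^ (-n)) ∈ adeleSubspace W := by
      rw [single_mem_adeleSubspace_iff, map_zpow₀]
      exact P.zpow_valuation_uniformizer_le_of_le (neg_le_neg hle)
    have h0 := hωW _ hmem
    rw [dOf_single] at h0
    exact hres h0
  · -- `n - 1 ≤ W P`: `dy ∈ Ω(D)` for `D = W` changed to `n - 1` at `P`
    set D := W.update P (n - 1) with hD
    suffices hmem : (dOf K y : Module.Dual K (Adele K F)) ∈ weilDifferentialSpace D by
      have := le_differentialDivisor_of_mem hω hmem P
      rw [hD, Finsupp.coe_update, Function.update_self, ← hW] at this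
      omega
    rw [mem_weilDifferentialSpace_iff']
    refine ⟨fun α hα ↦ ?_, weilDifferentialOfFun_algebraMap y⟩
    have hsplit : α = (α - Adele.single P (α P)) + Adele.single P (α P) := by abel
    have hβ : α - Adele.single P (α P) ∈ adeleSubspace W := by
      intro Q
      by_cases hQ : Q = P
      · subst hQ
        rw [Adele.sub_apply, Adele.single_apply_self, sub_self, map_zero]
        exact zero_le
      · rw [Adele.sub_apply, Adele.single_apply_of_ne hQ, sub_zero]
        have := hα Q
        rwa [hD, Finsupp.coe_update, Function.update_of_ne hQ] at this
    rw [hsplit, map_add, hωW _ hβ, zero_add, dOf_single]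
    refine PlaceOver.localRes_eq_zero_of_expansion hyexp ((P.valuation_eq_one_iff u).1 hu).1 ?_
    have := hα P
    rw [hD, Finsupp.coe_update, Function.update_self] at this
    rw [PlaceOver.mem_ball_iff]
    convert this using 2
    ring

/-- **Riemann–Hurwitz formula for a tame `y : F → ℙ¹`, all characteristics.** If all places of `F/K`
are rational (`K` the full constant field), `y ∈ F ∖ K`, and at every place `P` the integer
`diffOrd_P(y) + 1 = ± e_P` is non-zero in `K` (every place is tamely ramified in `F/K(y)`), then
`Σ_P diffOrd_P(y) = 2g - 2`, i.e. `2g - 2 = -2 [F : K(y)] + Σ_P (e_P - 1)`. In characteristic `0` the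
hypothesis is automatic (`finsum_diffOrd_eq`). [cite: Stichtenoth2009, Cor. 3.5.5, Thm. 3.4.13] -/
theorem finsum_diffOrd_eq_of_forall_cast_ne_zero (hrat : ∀ P : PlaceOver K F, P.IsRational) {y : F}
    (hy : y ∉ Set.range (algebraMap K F))
    (hnK : ∀ P : PlaceOver K F, ((P.diffOrd y + 1 : ℤ) : K) ≠ 0) :
    ∑ᶠ P : PlaceOver K F, P.diffOrd y = 2 * genus K F - 2 := by
  obtain ⟨P₀⟩ := nonempty_placeOver (K := K) (F := F)
  have hω : dOf K y ≠ 0 := dOf_ne_zero_of_cast_ne_zero (hrat P₀) hy (hnK P₀)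
  rw [← degree_differentialDivisor hω, Divisor.degree_eq_finsum hrat]
  exact finsum_congr fun P ↦
    (differentialDivisor_dOf_apply_of_cast_ne_zero hy hω (hrat P) (hnK P)).symm

end divisor

/-! ### An everywhere unramified `y` generates `F` -/

section unramified

variable [IsAlgFunctionField K F] [IsIntegrallyClosedIn K F]

omit [IsAlgFunctionField K F] [IsIntegrallyClosedIn K F] in
/-- At a finite place where `y` is unramified over `K(y)` — `v_P(y - y(P)) = 1` — `diffOrd_P(y) = 0`.
[cite: Stichtenoth2009, Thm. 3.5.1] -/
theorem PlaceOver.diffOrd_eq_zero_of_ord_sub_value {P : PlaceOver K F} {y : F}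
    (hyP : y ∈ P.toValuationSubring) (h : P.ord (y - algebraMap K F (P.value y)) = 1) :
    P.diffOrd y = 0 := by
  rw [PlaceOver.diffOrd, if_pos hyP, h]
  rfl

omit [IsAlgFunctionField K F] [IsIntegrallyClosedIn K F] in
/-- At a simple pole — `v_P(y) = -1` — `diffOrd_P(y) = -2`. [cite: Stichtenoth2009, Remark 4.3.7] -/
theorem PlaceOver.diffOrd_eq_neg_two_of_ord_eq_neg_one {P : PlaceOver K F} {y : F}
    (hyP : y ∉ P.toValuationSubring) (h : P.ord y = -1) : P.diffOrd y = -2 := by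
  rw [PlaceOver.diffOrd_of_not_mem _ hyP, h]
  rfl

/-- **An everywhere unramified `y` has degree one** (the computation behind SGA 1, XI 1.1 for `r = 1`:
"la formule du genre nous donne `1 - g' = d(1 - g)` […] ce qui exige `d = 1`"). Let `F/K` be an
algebraic function field with full constant field `K` all of whose places are rational, and
`y ∈ F ∖ K` such that `v_P(y - y(P)) = 1` at every place where `y` is finite and `v_P(y) = -1` at every
pole of `y` (every place of `F` is unramified over `K(y)`, including the places over `∞`). Then
`[F : K(y)] = 1`. Proof: `diffOrd_P(y)` is `0` at the finite places and `-2` at the poles, so the tame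
Riemann–Hurwitz formula applies in every characteristic and gives `2g - 2 = -2 · #{poles}`; the poles,
all simple and rational, number `deg (y)_∞ = [F : K(y)]` (Stichtenoth Thm. 1.4.11); hence
`g - 1 = -[F : K(y)] ≤ -1 ≤ g - 1`. [cite: SGA1, Exp. XI Prop. 1.1 (r = 1)] -/
theorem finrank_eq_one_of_unramified (hrat : ∀ P : PlaceOver K F, P.IsRational) {y : F}
    (hy : y ∉ Set.range (algebraMap K F))
    (hfin : ∀ P : PlaceOver K F, y ∈ P.toValuationSubring →
      P.ord (y - algebraMap K F (P.value y)) = 1)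
    (hinf : ∀ P : PlaceOver K F, y ∉ P.toValuationSubring → P.ord y = -1) :
    Module.finrank K⟮y⟯ F = 1 ∧ genus K F = 0 := by
  have hyt : Transcendental K y := transcendental_of_not_mem_range hy
  haveI := IsAlgFunctionField.finiteDimensional_adjoin_simple hyt
  -- the values of `diffOrd`
  have hdfin : ∀ P : PlaceOver K F, y ∈ P.toValuationSubring → P.diffOrd y = 0 :=
    fun P hP ↦ PlaceOver.diffOrd_eq_zero_of_ord_sub_value hP (hfin P hP)
  have hdinf : ∀ P : PlaceOver K F, y ∉ P.toValuationSubring → P.diffOrd y = -2 :=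
    fun P hP ↦ PlaceOver.diffOrd_eq_neg_two_of_ord_eq_neg_one hP (hinf P hP)
  have hnK : ∀ P : PlaceOver K F, ((P.diffOrd y + 1 : ℤ) : K) ≠ 0 := by
    intro P
    by_cases hP : y ∈ P.toValuationSubring
    · rw [hdfin P hP]; norm_num
    · rw [hdinf P hP]; norm_num
  -- the finite set `U` of poles
  set U : Finset (PlaceOver K F) := (algebraMap F (Adele K F) y).finite_setOf_not_mem.toFinset with hU
  have hmemU : ∀ P : PlaceOver K F, P ∈ U ↔ y ∉ P.toValuationSubring := fun P ↦ by
    rw [hU, Set.Finite.mem_toFinset]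
    rfl
  have hy0 : y ≠ 0 := fun h ↦ hy ⟨0, by rw [h, map_zero]⟩
  have hordU : ∀ P : PlaceOver K F, P.ord y < 0 ↔ y ∉ P.toValuationSubring := fun P ↦ by
    rw [P.mem_toValuationSubring_iff_ord_nonneg hy0, not_le]
  -- `#U = [F : K(y)]`
  have hcard : (U.card : ℤ) = Module.finrank K⟮y⟯ F := by
    rw [← sum_neg_ord_eq_finrank hrat hy U (fun P hP ↦ (hordU P).2 ((hmemU P).1 hP))
      (fun P hP ↦ (hmemU P).2 ((hordU P).1 hP))]
    rw [Finset.card_eq_sum_ones, Nat.cast_sum]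
    refine Finset.sum_congr rfl fun P hP ↦ ?_
    rw [hinf P ((hmemU P).1 hP)]
    norm_num
  -- the Hurwitz sum is `-2 #U`
  have hsupp : Function.support (fun P : PlaceOver K F ↦ P.diffOrd y) ⊆ (U : Set (PlaceOver K F)) := by
    intro P hP
    rw [Finset.mem_coe, hmemU]
    intro hyP
    exact hP (hdfin P hyP)
  have hsum : ∑ᶠ P : PlaceOver K F, P.diffOrd y = -2 * (U.card : ℤ) := by
    rw [finsum_eq_sum_of_support_subset _ hsupp, Finset.card_eq_sum_ones, Nat.cast_sum, Finset.mul_sum]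
    refine Finset.sum_congr rfl fun P hP ↦ ?_
    rw [hdinf P ((hmemU P).1 hP)]
    norm_num
  have hRH := finsum_diffOrd_eq_of_forall_cast_ne_zero hrat hy hnK
  rw [hsum, hcard] at hRH
  have hpos : 0 < Module.finrank K⟮y⟯ F := Module.finrank_pos
  constructor <;> omega

/-- The genus of a function field carrying an everywhere unramified `y ∉ K` is `0`
(`finrank_eq_one_of_unramified`). [cite: SGA1, Exp. XI Prop. 1.1 (r = 1)] -/
theorem genus_eq_zero_of_unramified (hrat : ∀ P : PlaceOver K F, P.IsRational) {y : F}
    (hy : y ∉ Set.range (algebraMap K F))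
    (hfin : ∀ P : PlaceOver K F, y ∈ P.toValuationSubring →
      P.ord (y - algebraMap K F (P.value y)) = 1)
    (hinf : ∀ P : PlaceOver K F, y ∉ P.toValuationSubring → P.ord y = -1) :
    genus K F = 0 :=
  (finrank_eq_one_of_unramified hrat hy hfin hinf).2

/-- **`F = K(y)` for an everywhere unramified `y ∉ K`** (`finrank_eq_one_of_unramified` restated:
`K⟮y⟯ = ⊤`). [cite: SGA1, Exp. XI Prop. 1.1 (r = 1)] -/
theorem adjoin_simple_eq_top_of_unramified (hrat : ∀ P : PlaceOver K F, P.IsRational) {y : F}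
    (hy : y ∉ Set.range (algebraMap K F))
    (hfin : ∀ P : PlaceOver K F, y ∈ P.toValuationSubring →
      P.ord (y - algebraMap K F (P.value y)) = 1)
    (hinf : ∀ P : PlaceOver K F, y ∉ P.toValuationSubring → P.ord y = -1) :
    K⟮y⟯ = ⊤ := by
  have hyt : Transcendental K y := transcendental_of_not_mem_range hy
  haveI := IsAlgFunctionField.finiteDimensional_adjoin_simple hyt
  exact IntermediateField.finrank_eq_one_iff_eq_top.1 (finrank_eq_one_of_unramified hrat hy hfin hinf).1

end unramified

end Literature.NumberTheory.DiophantineGeometry.AlgFunctionField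

end
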